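import Literature.Topology.PlanarFoliations.HugState
import Literature.Topology.PlanarFoliations.ProngAccumulation
import Literature.Topology.PlanarFoliations.ChainCrossingStar
import HarnessLib

/-!
# Hugging frames: the hugged walk for an abstract hugger

Topic: Topology / PlanarFoliations, a generalisation of `HugState.lean`. There the separatrices of
the frontier of the limit set `Dlim` of a chain of compact leaves `K n` are walked along, the
chain crossing the star verticals near them (`HugWalk`, `HugStep`, `HugOrbit`, `OrbitCycle`). The
same walk is driven by other huggers — an open leaf accumulating on a separatrix graph — and only
a handful of properties of the pair (hugged set, hugger) are ever used. We record them as a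
**hugging frame** `StarData.HugFrame D hbi hι C G A` (a `Prop` structure): `C` a compact set,
`G ⊆ ℂ` the *hugged set* where the states live, `A : ℕ → X` base points of the *hugger leaves*
`F.leaf (A n)`, with

* `hC`, `memC`, `sat`: `C` is compact, the leaves through the points of `G` lie in `C`, and `G` is
  saturated;
* `sep`: the leaf through a point of `G` is a line leaf whose ω- and α-limit sets are single
  punctures, of which it is a level leaf (the frontier dichotomy of `ChainLimit`);
* `cross`: at a prong point of `G` of a star of `D`, the hugger leaves cross the star vertical on
  one side at heights accumulating to `0` (as `ChainCrossingStar.exists_leaf_crossing_star`);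
* `swept`: the points of a prong swept by horizontals of the hugger leaves at heights accumulating
  to `0` are in `G` (as `ProngAccumulation.pt_mem_frontier_Dlim_of_horiz`).

Then, verbatim as in `HugState.lean` (the line-leaf instance being `(Fr.sep _ hy).1`, inlined to
avoid restating `HugHyp.nc`): the API of the separatrices through `G` (`mem_C`,
`mem_G_of_mem_leaf`, `vω`, `vα`, `omegaSet_eq`, `alphaSet_eq`, `nonempty_fwdTail`,
`nonempty_bwdTail`), the **states** `StarData.FState ι F G` (a point of `G`) with arrival saddle
`v`, arrival prong `jin` and next prong `jout s`, and the **chain frame** `StarData.HugHyp.frame`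
(`G = frontier Dlim`, `A = K`, `C = discLeaf (K 0)`).

## References

* C. Camacho, A. Lins Neto, *Geometric Theory of Foliations*, Birkhäuser (1985), Ch. VII §2
  [CamachoLinsNeto1985].
-/

noncomputable section

open Set Filter Function Metric
open _root_.Topology
open Literature.Topology.FourManifolds Literature.Topology.FourManifolds.Foliation

namespace Literature.Topology.PlanarFoliations

variable {X : Type*} [TopologicalSpace X] [T2Space X] [SecondCountableTopology X] [Nonempty X] {F : Foliation ℝ X} {ι : X → ℂ}

namespace StarData

variable {B : Type*} [NormedAddCommGroup B] {M : Type*} [TopologicalSpace M] {T : Foliation B M} {g : ℂ → M}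

/-- **A hugging frame**: a compact set `C`, a hugged set `G` of points of line separatrices with
single saddle limit sets, saturated, and hugger leaves `F.leaf (A n)` crossing the star verticals
at the points of `G` on one side at small heights, the prongs they sweep being in `G`. [folklore] -/
structure HugFrame (D : StarData F ι T g) (hbi : IsBiOriented F) (hι : IsOpenEmbedding ι) (C G : Set ℂ) (A : ℕ → X) : Prop where
  hC : IsCompact C
  memC : ∀ y, ι y ∈ G → ∀ y' ∈ F.leaf y, ι y' ∈ C
  sat : ∀ y, ι y ∈ G → ∀ y' ∈ F.leaf y, ι y' ∈ G
  sep : ∀ y, ι y ∈ G → ∃ _ : NoncompactSpace (F.Leaf y),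
    (∃ v ∈ D.P, omegaSet hbi ι y = {v} ∧ ∃ s ∈ D.levelLeaves v, y ∈ F.leaf s) ∧
    (∃ v ∈ D.P, alphaSet hbi ι y = {v} ∧ ∃ s ∈ D.levelLeaves v, y ∈ F.leaf s)
  cross : ∀ {v : ℂ} (hv : D.nprong v ≠ 0) {j : ZMod (D.nprong v)} {β r : ℝ}, β ∈ Ioo 0 (D.star v hv).ρ → 0 < r →
    ball ((D.star v hv).pt j (β, 0)) r ⊆ (D.star v hv).S j \ {v} → (D.star v hv).pt j (β, 0) ∈ G →
    ∃ s : ℝ, (s = 1 ∨ s = -1) ∧ ∀ ε > 0, ∃ N, ∀ m ≥ N, ∃ h, 0 < s * h ∧ |h| < ε ∧ (D.star v hv).horiz hι j h β ∈ F.leaf (A m)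
  swept : ∀ {v : ℂ} (hv : D.nprong v ≠ 0) {j : ZMod (D.nprong v)},
    (∀ N, ∀ δ > (0 : ℝ), ∃ m ≥ N, ∃ h : ℝ, h ≠ 0 ∧ |h| < δ ∧
      ∀ b ∈ Icc 0 (D.star v hv).ρ, (D.star v hv).horiz hι j h b ∈ F.leaf (A m)) →
    ∀ b ∈ Ioc 0 (D.star v hv).ρ, (D.star v hv).pt j (b, 0) ∈ G

namespace HugFrame

variable {D : StarData F ι T g} {hbi : IsBiOriented F} {hι : IsOpenEmbedding ι} {C G : Set ℂ} {A : ℕ → X}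
  (Fr : D.HugFrame hbi hι C G A)
variable {y : X} (hy : ι y ∈ G)

include Fr hy in
/-- A leaf through the hugged set lies in `C`. [folklore] -/
theorem mem_C (q : F.Leaf y) : ι (Leaf.pt q) ∈ C := Fr.memC y hy _ q.2

include Fr hy in
/-- The points of a leaf through the hugged set are in the hugged set. [folklore] -/
theorem mem_G_of_mem_leaf {y' : X} (hy' : y' ∈ F.leaf y) : ι y' ∈ G := Fr.sat y hy y' hy'

/-- **The ω-saddle** of the leaf. [folklore] -/
def vω : ℂ := (Fr.sep y hy).2.1.choose

/-- **The α-saddle** of the leaf. [folklore] -/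
def vα : ℂ := (Fr.sep y hy).2.2.choose

/-- The ω-saddle is a puncture. [folklore] -/
theorem vω_mem : Fr.vω hy ∈ D.P := (Fr.sep y hy).2.1.choose_spec.1

/-- The α-saddle is a puncture. [folklore] -/
theorem vα_mem : Fr.vα hy ∈ D.P := (Fr.sep y hy).2.2.choose_spec.1

/-- The ω-limit set is the ω-saddle. [folklore] -/
theorem omegaSet_eq : haveI := (Fr.sep _ hy).1; omegaSet hbi ι y = {Fr.vω hy} := (Fr.sep y hy).2.1.choose_spec.2.1

/-- The α-limit set is the α-saddle. [folklore] -/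
theorem alphaSet_eq : haveI := (Fr.sep _ hy).1; alphaSet hbi ι y = {Fr.vα hy} := (Fr.sep y hy).2.2.choose_spec.2.1

/-- The leaf is a level leaf of its ω-saddle. [folklore] -/
theorem exists_levelLeaves_ω : ∃ s ∈ D.levelLeaves (Fr.vω hy), y ∈ F.leaf s := (Fr.sep y hy).2.1.choose_spec.2.2

/-- The leaf is a level leaf of its α-saddle. [folklore] -/
theorem exists_levelLeaves_α : ∃ s ∈ D.levelLeaves (Fr.vα hy), y ∈ F.leaf s := (Fr.sep y hy).2.2.choose_spec.2.2

/-- The ω-saddle is a saddle. [folklore] -/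
theorem nprong_vω_ne_zero : D.nprong (Fr.vω hy) ≠ 0 :=
  haveI := (Fr.sep _ hy).1
  D.nprong_ne_zero_of_omegaSet (Fr.vω_mem hy) Fr.hC (Fr.mem_C hy) (Fr.omegaSet_eq hy)

/-- The α-saddle is a saddle. [folklore] -/
theorem nprong_vα_ne_zero : D.nprong (Fr.vα hy) ≠ 0 :=
  haveI := (Fr.sep _ hy).1
  D.nprong_ne_zero_of_alphaSet (Fr.vα_mem hy) Fr.hC (Fr.mem_C hy) (Fr.alphaSet_eq hy)

/-- **A forward tail at the ω-saddle.** [folklore] -/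
theorem nonempty_fwdTail : haveI := (Fr.sep _ hy).1; Nonempty ((D.star _ (Fr.nprong_vω_ne_zero hy)).FwdTail hbi y) :=
  haveI := (Fr.sep _ hy).1
  (D.exists_fwdTail hι (Fr.vω_mem hy) Fr.hC (Fr.mem_C hy) (Fr.omegaSet_eq hy)).snd

/-- **A backward tail at the α-saddle.** [folklore] -/
theorem nonempty_bwdTail : haveI := (Fr.sep _ hy).1; Nonempty ((D.star _ (Fr.nprong_vα_ne_zero hy)).BwdTail hbi y) :=
  haveI := (Fr.sep _ hy).1
  (D.exists_bwdTail hι (Fr.vα_mem hy) Fr.hC (Fr.mem_C hy) (Fr.alphaSet_eq hy)).snd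

end HugFrame

/-! ## States of the hugged walk -/

/-- **A state of the hugged walk**: a point of the hugged set — the separatrix that has just arrived
at its ω-saddle. [folklore] -/
structure FState (ι : X → ℂ) (F : Foliation ℝ X) (G : Set ℂ) where
  /-- a point of the separatrix -/
  y : X
  hy : ι y ∈ G

namespace FState

variable {D : StarData F ι T g} {hbi : IsBiOriented F} {hι : IsOpenEmbedding ι} {C G : Set ℂ} {A : ℕ → X}
  (Fr : D.HugFrame hbi hι C G A) (st : FState ι F G)

/-- The arrival saddle. [folklore] -/
def v : ℂ := Fr.vω st.hy

/-- The arrival saddle is a saddle. [folklore] -/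
theorem hv : D.nprong (st.v Fr) ≠ 0 := Fr.nprong_vω_ne_zero st.hy

/-- The chosen arrival tail. [folklore] -/
def Ef : haveI := (Fr.sep _ st.hy).1; (D.star _ (st.hv Fr)).FwdTail hbi st.y := Classical.choice (Fr.nonempty_fwdTail st.hy)

/-- **The arrival prong.** [folklore] -/
def jin : ZMod (D.nprong (st.v Fr)) := haveI := (Fr.sep _ st.hy).1; (st.Ef Fr).j

/-- The arrival prong does not depend on the choice of the tail. [folklore] -/
theorem jin_eq (E : haveI := (Fr.sep _ st.hy).1; (D.star _ (st.hv Fr)).FwdTail hbi st.y) : haveI := (Fr.sep _ st.hy).1; E.j = st.jin Fr := by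
  haveI := (Fr.sep _ st.hy).1
  show E.j = (st.Ef Fr).j
  exact ProngStar.FwdTail.j_eq E (st.Ef Fr)

/-- **The next prong on the side `s`** (the turning rule, as in `WalkJunction.turn`). [folklore] -/
def jout (s : ℝ) : ZMod (D.nprong (st.v Fr)) :=
  if 0 ≤ (D.star _ (st.hv Fr)).sg (st.jin Fr) * s then st.jin Fr + 1 else st.jin Fr - 1

/-- The arrival saddle is the ω-limit set. [folklore] -/
theorem omegaSet_eq : haveI := (Fr.sep _ st.hy).1; omegaSet hbi ι st.y = {st.v Fr} := Fr.omegaSet_eq st.hy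

end FState

/-! ## The chain frame -/

namespace HugHyp

variable {D : StarData F ι T g} {hbi : IsBiOriented F} {hι : IsOpenEmbedding ι} {K : ℕ → X} (H : D.HugHyp hbi hι K)

include H in
/-- **The frame of a chain of compact leaves**: hugged set the frontier of the limit set, hugger
leaves the leaves of the chain, ambient compact set the first disc. [folklore] -/
theorem frame : D.HugFrame hbi hι (discLeaf F ι (K 0)) (frontier (Dlim ι F K)) K where
  hC := isCompact_discLeaf hbi hι (H.hK 0)
  memC _ hy y' hy' := H.mem_disc hy (Leaf.mk y' hy')
  sat _ hy _ hy' := H.frontier_of_mem_leaf hy hy'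
  sep _ hy := H.sep hy
  cross _ _ _ _ hβ hr hball hx₀ := ProngStar.exists_leaf_crossing_star _ hbi hι H.hK H.hdec hβ hr hball hx₀
  swept hv _ hpass _ hb := (D.star _ hv).pt_mem_frontier_Dlim_of_horiz hbi hι H.hK H.hdec hpass hb

end HugHyp

end StarData

end Literature.Topology.PlanarFoliations
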